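import Literature.Probability.Percolation.CutBlocksConn
import Literature.Probability.Percolation.CutBlocksFaces
import HarnessLib

/-!
# The zones of a cut with the lakes filled into the collar

Topic `Probability/Percolation`.  Support file (definitions and proofs, no named fact) for the named
fact `SchrammSmirnov2011_thm_1_7` (zone geometry of the proof of Prop. 4.1, Ann. Probab. 39 (2011),
§4).  The digitised window `Kset ∪ Nset` of a cut may enclose LAKES — bounded components of its
complement (pinched regions, or the inside of loops of `α`).  We fill them into the collar:
`zonesFilled` has the same tube `N = Nset`, the collar `K = Kset ∪ lakes`, no squares.  Then the
outside is walkable to infinity by construction (`zonesFilled_W_esc`: escaping is invariant along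
free steps), the lakes lie in a box around the window (`lake_subset_box`, so the collar is finite),
the tube properties are those of the digitisation (`zonesFilled_N_nbr`, `zonesFilled_N_conn`), so the
filled zones are NICE (`nice_zonesFilled`, for connected cuts and meshes `δ < s`), and they are
compatible with the digitisation (`compat_zonesFilled`), so that the landing count of
`CutBlocksFaces.lean` / `CutBlocksLegCount*.lean` applies to them.

## References

* O. Schramm, S. Smirnov, *On the scaling limits of planar percolation*, Ann. Probab. 39 (2011)
  1768–1814, arXiv:1101.5820, §4, proof of Prop. 4.1 (the sets K and M). [SchrammSmirnov2011]
-/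

noncomputable section

open Set Metric Relation
open Literature.Probability.LatticeModels
open scoped Classical

namespace Literature.Probability.Percolation

namespace CutBlocks

open CellComplex (OutsideBox)

variable {s : ℝ} {α : Set ℂ} {δ : ℝ}

/-! ### The window and the free steps -/

/-- The digitised window: ring collar and tube sites. [folklore] -/
def W₀ (s : ℝ) (α : Set ℂ) (δ : ℝ) : Set (Site 2) := Kset s α δ ∪ Nset s α δ

/-- Free steps: lattice steps outside the window. [folklore] -/
def FreeStep (s : ℝ) (α : Set ℂ) (δ : ℝ) (a b : Site 2) : Prop :=
  a ∉ W₀ s α δ ∧ b ∉ W₀ s α δ ∧ ∃ k : Fin 4, b = a + cornerUnit k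

/-- Escaping to infinity through free steps. [folklore] -/
def Esc (s : ℝ) (α : Set ℂ) (δ : ℝ) (v : Site 2) : Prop :=
  ∀ R : ℝ, ∃ u : Site 2, R < ‖Site.toComplex u‖ ∧ ReflTransGen (FreeStep s α δ) v u

/-- Free steps are symmetric. [folklore] -/
theorem freeStep_symm {a b : Site 2} (h : FreeStep s α δ a b) : FreeStep s α δ b a := by
  obtain ⟨ha, hb, k, rfl⟩ := h
  exact ⟨hb, ha, k + 2, by rw [add_assoc, cornerUnit_add_two]; simp⟩

/-- Escaping is invariant along free steps. [folklore] -/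
theorem esc_iff_of_freeStep {a b : Site 2} (h : FreeStep s α δ a b) : Esc s α δ a ↔ Esc s α δ b := by
  constructor
  · intro ha R
    obtain ⟨u, hu, hchain⟩ := ha R
    exact ⟨u, hu, ReflTransGen.head (freeStep_symm h) hchain⟩
  · intro hb R
    obtain ⟨u, hu, hchain⟩ := hb R
    exact ⟨u, hu, ReflTransGen.head h hchain⟩

/-- Escaping is invariant along chains of free steps. [folklore] -/
theorem esc_of_reflTransGen {a b : Site 2} (h : ReflTransGen (FreeStep s α δ) a b) (ha : Esc s α δ a) : Esc s α δ b := by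
  induction h with
  | refl => exact ha
  | tail _ hst ih => exact (esc_iff_of_freeStep hst).1 ih

/-! ### A box around the window -/

/-- **A box around the window.** [folklore] -/
theorem exists_box (hs : 0 < s) (hδ : 0 < δ) (hα : Bornology.IsBounded α) :
    ∃ R : ℕ, ∀ v ∈ W₀ s α δ, |v 0| ≤ R ∧ |v 1| ≤ R := by
  have hfin : (W₀ s α δ).Finite := (Kset_finite hs hδ hα).union (Nset_finite hs hδ hα)
  refine ⟨hfin.toFinset.sup fun v : Site 2 => max (|v 0|).toNat (|v 1|).toNat, fun v hv => ?_⟩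
  have h := Finset.le_sup (f := fun v : Site 2 => max (|v 0|).toNat (|v 1|).toNat) (hfin.mem_toFinset.2 hv)
  simp only [max_le_iff] at h
  have h0 := Int.self_le_toNat (|v 0|)
  have h1 := Int.self_le_toNat (|v 1|)
  constructor <;> omega

/-- Sites outside the box are outside the window. [folklore] -/
theorem not_mem_W₀_of_outsideBox {R : ℕ} (hR : ∀ v ∈ W₀ s α δ, |v 0| ≤ R ∧ |v 1| ≤ R) {v : Site 2}
    (hv : OutsideBox R v) : v ∉ W₀ s α δ := fun h => by
  obtain ⟨h0, h1⟩ := hR v h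
  rcases hv with h | h <;> omega

/-- Sites outside the box are joined by free steps. [folklore] -/
theorem reflTransGen_freeStep_of_outsideBox {R : ℕ} (hR : ∀ v ∈ W₀ s α δ, |v 0| ≤ R ∧ |v 1| ≤ R) {v w : Site 2}
    (hv : OutsideBox R v) (hw : OutsideBox R w) : ReflTransGen (FreeStep s α δ) v w := by
  have hchain := CellComplex.reflTransGen_outsideBox (R := R) (by positivity) hv hw
  clear hw
  induction hchain with
  | refl => exact ReflTransGen.refl
  | tail _ hst ih =>
    obtain ⟨ha, hb, hadj⟩ := hst
    exact ih.tail ⟨not_mem_W₀_of_outsideBox hR ha, not_mem_W₀_of_outsideBox hR hb,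
      CellComplex.adj_iff_exists_cornerUnit.1 hadj⟩

/-- **Sites outside the box escape.** [folklore] -/
theorem esc_of_outsideBox {R : ℕ} (hR : ∀ v ∈ W₀ s α δ, |v 0| ≤ R ∧ |v 1| ≤ R) {v : Site 2}
    (hv : OutsideBox R v) : Esc s α δ v := by
  intro R'
  obtain ⟨n, hn⟩ : ∃ n : ℕ, max R' (R : ℝ) + 1 < n := exists_nat_gt _
  have hwout : OutsideBox R (fun _ => (n : ℤ) : Site 2) := by
    left
    have : (R : ℝ) < n := by linarith [le_max_right R' (R : ℝ)]
    have : (R : ℤ) < n := by exact_mod_cast this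
    simpa using this.trans_le (le_abs_self _)
  have hwnorm : R' < ‖Site.toComplex (fun _ => (n : ℤ) : Site 2)‖ := by
    have h1 := Complex.abs_re_le_norm (Site.toComplex (fun _ => (n : ℤ) : Site 2))
    rw [Site.toComplex_re] at h1
    have h2 : (((fun _ => (n : ℤ) : Site 2) 0 : ℤ) : ℝ) = n := by simp
    rw [h2] at h1
    have h3 : (n : ℝ) ≤ |(n : ℝ)| := le_abs_self _
    linarith [le_max_left R' (R : ℝ)]
  exact ⟨_, hwnorm, reflTransGen_freeStep_of_outsideBox hR hv hwout⟩

/-! ### The lakes -/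

/-- **The lakes**: sites outside the window that do not escape. [folklore] -/
def lakeSet (s : ℝ) (α : Set ℂ) (δ : ℝ) : Set (Site 2) := {v | v ∉ W₀ s α δ ∧ ¬ Esc s α δ v}

/-- The lakes lie in the box. [folklore] -/
theorem lake_subset_box {R : ℕ} (hR : ∀ v ∈ W₀ s α δ, |v 0| ≤ R ∧ |v 1| ≤ R) :
    lakeSet s α δ ⊆ {v : Site 2 | |v 0| ≤ R ∧ |v 1| ≤ R} := by
  rintro v ⟨-, hv⟩
  by_contra h
  simp only [mem_setOf_eq, not_and_or, not_le] at h
  exact hv (esc_of_outsideBox hR (by rcases h with h | h <;> [exact Or.inl h; exact Or.inr h]))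

/-- Sites in a box form a finite set. [folklore] -/
theorem finite_box (R : ℕ) : {v : Site 2 | |v 0| ≤ R ∧ |v 1| ≤ R}.Finite := by
  refine (Set.Finite.pi (t := fun _ : Fin 2 => Set.Icc (-(R : ℤ)) R) fun _ => Set.finite_Icc _ _).subset ?_
  intro v hv
  simp only [mem_setOf_eq, abs_le] at hv
  simp only [Set.mem_pi, Set.mem_univ, Set.mem_Icc, forall_true_left]
  intro i; fin_cases i
  · exact ⟨hv.1.1, hv.1.2⟩
  · exact ⟨hv.2.1, hv.2.2⟩

/-- The lakes form a finite set. [folklore] -/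
theorem lakeSet_finite (hs : 0 < s) (hδ : 0 < δ) (hα : Bornology.IsBounded α) : (lakeSet s α δ).Finite := by
  obtain ⟨R, hR⟩ := exists_box hs hδ hα
  exact (finite_box R).subset (lake_subset_box hR)

/-! ### The filled zones -/

/-- **The zones of the cut with the lakes filled into the collar.** [cite: SchrammSmirnov2011, §4, proof of Prop. 4.1 (the sets K and M)] -/
def zonesFilled (hs : 0 < s) (hδ : 0 < δ) (hα : Bornology.IsBounded α) : Seeded.Zones where
  K := (Kset_finite (α := α) hs hδ hα).toFinset ∪ (lakeSet_finite (α := α) hs hδ hα).toFinset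
  N := (Nset_finite (α := α) hs hδ hα).toFinset
  SQ := ∅
  disjoint_K_N := by
    rw [Finset.disjoint_left]
    intro v hv hv'
    rw [Finset.mem_union, Set.Finite.mem_toFinset, Set.Finite.mem_toFinset] at hv
    rw [Set.Finite.mem_toFinset] at hv'
    rcases hv with h | h
    · exact Set.disjoint_left.1 disjoint_Kset_Nset h hv'
    · exact h.1 (Or.inr hv')
  disjoint_K_SQ := Finset.disjoint_empty_right _
  disjoint_N_SQ := Finset.disjoint_empty_right _

variable {hs : 0 < s} {hδ : 0 < δ} {hα : Bornology.IsBounded α}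

/-- Membership in the collar of the filled zones. [folklore] -/
theorem mem_zonesFilled_K {v : Site 2} : v ∈ (zonesFilled hs hδ hα).K ↔ v ∈ Kset s α δ ∨ v ∈ lakeSet s α δ := by
  simp [zonesFilled, Set.Finite.mem_toFinset]

/-- The tube of the filled zones is the tube of the digitisation. [folklore] -/
theorem zonesFilled_N : (zonesFilled hs hδ hα).N = (zones hs hδ hα).N := rfl

/-- Membership in the tube of the filled zones. [folklore] -/
theorem mem_zonesFilled_N {v : Site 2} : v ∈ (zonesFilled hs hδ hα).N ↔ v ∈ Nset s α δ := mem_zones_N hs hδ hα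

/-- **The filled zones are compatible with the digitisation.** [folklore] -/
theorem compat_zonesFilled : Compat hs hδ hα (zonesFilled hs hδ hα) where
  N_eq := rfl
  K_sub := fun _ hv => mem_zonesFilled_K.2 (Or.inl ((mem_zones_K hs hδ hα).1 hv))
  SQ_eq := rfl

/-- Sites outside the filled window are outside the digitised window and escape. [folklore] -/
theorem esc_of_not_mem {u : Site 2} (huK : u ∉ (zonesFilled hs hδ hα).K) (huN : u ∉ (zonesFilled hs hδ hα).N) :
    u ∉ W₀ s α δ ∧ Esc s α δ u := by
  rw [mem_zonesFilled_K, not_or] at huK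
  rw [mem_zonesFilled_N] at huN
  have hW : u ∉ W₀ s α δ := fun h => h.elim huK.1 huN
  refine ⟨hW, ?_⟩
  by_contra h
  exact huK.2 ⟨hW, h⟩

/-- **The outside of the filled window is walkable to infinity.** [folklore] -/
theorem zonesFilled_W_esc : ∀ u, u ∉ (zonesFilled hs hδ hα).K → u ∉ (zonesFilled hs hδ hα).N → ∀ R : ℝ,
    ∃ u', R < ‖Site.toComplex u'‖ ∧
      ReflTransGen (fun a b => (a ∉ (zonesFilled hs hδ hα).K ∧ a ∉ (zonesFilled hs hδ hα).N) ∧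
        (b ∉ (zonesFilled hs hδ hα).K ∧ b ∉ (zonesFilled hs hδ hα).N) ∧ ∃ k : Fin 4, b = a + cornerUnit k) u u' := by
  intro u huK huN R
  obtain ⟨huW, hesc⟩ := esc_of_not_mem huK huN
  obtain ⟨u', hu', hchain⟩ := hesc R
  refine ⟨u', hu', ?_⟩
  -- along the chain every site is outside the window and escapes, hence is not a lake
  have key : ∀ {a b : Site 2}, ReflTransGen (FreeStep s α δ) a b → Esc s α δ a →
      ReflTransGen (fun a b => (a ∉ (zonesFilled hs hδ hα).K ∧ a ∉ (zonesFilled hs hδ hα).N) ∧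
        (b ∉ (zonesFilled hs hδ hα).K ∧ b ∉ (zonesFilled hs hδ hα).N) ∧ ∃ k : Fin 4, b = a + cornerUnit k) a b := by
    intro a b h ha
    induction h with
    | refl => exact ReflTransGen.refl
    | @tail x y hax hxy ih =>
      have hx : Esc s α δ x := esc_of_reflTransGen hax ha
      have hy : Esc s α δ y := (esc_iff_of_freeStep hxy).1 hx
      obtain ⟨hxW, hyW, k, hk⟩ := hxy
      have out : ∀ {v}, v ∉ W₀ s α δ → Esc s α δ v → v ∉ (zonesFilled hs hδ hα).K ∧ v ∉ (zonesFilled hs hδ hα).N := by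
        intro v hvW hv
        refine ⟨fun h => ?_, fun h => hvW (Or.inr (mem_zonesFilled_N.1 h))⟩
        rcases mem_zonesFilled_K.1 h with h | h
        · exact hvW (Or.inl h)
        · exact h.2 hv
      exact ih.tail ⟨out hxW hx, out hyW hy, k, hk⟩
  exact key hchain hesc

/-- **Tube sites of the filled zones have no far neighbours** (meshes `δ < s`). [folklore] -/
theorem zonesFilled_N_nbr (hδs : δ < s) : ∀ v ∈ (zonesFilled hs hδ hα).N, ∀ k : Fin 4,
    v + cornerUnit k ∈ (zonesFilled hs hδ hα).K ∨ v + cornerUnit k ∈ (zonesFilled hs hδ hα).N ∨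
      v + cornerUnit k ∈ (zonesFilled hs hδ hα).SQ := by
  intro v hv k
  rcases zones_N_nbr hs hδ hδs hα v hv k with h | h | h
  · exact Or.inl (compat_zonesFilled.K_sub h)
  · exact Or.inr (Or.inl h)
  · simp at h

/-- **The filled zones of a connected cut are nice** (meshes `δ < s`). [cite: SchrammSmirnov2011, §4, proof of Prop. 4.1] -/
theorem nice_zonesFilled (hδs : δ < s) (hαc : IsPreconnected α) : (zonesFilled hs hδ hα).Nice where
  N_nbr := zonesFilled_N_nbr hδs
  N_conn := zones_N_conn hs hδ hδs.le hα hαc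
  W_esc := zonesFilled_W_esc

end CutBlocks

end Literature.Probability.Percolation

end
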